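import Literature.Probability.Percolation.SlabCircuitSideCrossings
import Literature.Probability.Percolation.SlabBoxCrossingPropertyAnnuli
import Literature.Probability.Percolation.SlabRSWHalfSide
import HarnessLib

/-!
# Newman–Tassion–Wu 2017, Theorem 3.10 — (3.66)–(3.74): the four side crossings with unique hub
# clusters have probability at least half the product of the side-crossing probabilities

Topic: `Literature/Probability/Percolation`. Seventh file of the port of THEOREM 3.10 of
Newman–Tassion–Wu, *Critical percolation and the minimal spanning tree in slabs* (CPAM 70 (2017);
arXiv:1512.09107, p. 13): "`P[ℰ] ≥ P[ℰ₀] - P[ℰ₀ ∖ 𝒰₁] - P[ℰ₀ ∖ 𝒰₂]` … Harris–FKG … independence and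
then the BK inequality … `P[ℰ] ≥ (c₁²/2) P[B(S₁) ⟷ R(S₁)]²`".  In the port's geometry
(`SlabCircuitSideCrossings.lean`: `ℰ₀ = sideCrossT ∩ sideCrossR ∩ sideCrossB ∩ sideCrossL`, hub
uniqueness events `hubUniq*` of `SlabCircuitFromCornerLinks.lean`):

* `determinedBy_linked`, `measurableSet_linked_boxR` — locality of the
  uniqueness events; lifts of disjoint planar regions have disjoint edge sets.
* `real_defect_le` — one defect: `P[(K ∩ Rest) ∖ 𝒰] ≤ δ P[K ∩ Rest]` when `P[hub crossed]² ≤ δ P[K]`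
  (`real_inter_compl_linked_le` + Harris–FKG).
* **`real_sideCross_inter_hubUniq_ge`** — `P[ℰ₀ ∩ 𝒰⁴] ≥ ½ · Π_X P[sideCross_X]` when
  `P[hubCross_X]² ≤ δ P[sideCross_X]` for the four sides, `0 ≤ δ`, `4δ ≤ 1/2`.

## Sources

* C. M. Newman, V. Tassion, W. Wu, *Critical percolation and the minimal spanning tree in slabs*,
  Comm. Pure Appl. Math. 70 (2017) 2084–2120, arXiv:1512.09107: proof of Theorem 3.10, displays
  (3.66)–(3.74) (p. 13) [NewmanTassionWu2017].
-/

noncomputable section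

namespace Literature.Probability.Percolation

open MeasureTheory LatticeModels
open scoped LatticeModels

namespace NTW17

variable {k : ℕ}

/-! ## Locality of the uniqueness events -/

/-- `linked k X E₁ E₂` is determined by the edges inside the lift of any `T ⊇ X`.
[cite: NewmanTassionWu2017, Theorem 3.10 (proof, "measurable with respect to the edge variables in S₁ and S₂")] -/
theorem determinedBy_linked {X T : Set (ℤ × ℤ)} (E₁ E₂ : Set (ℤ × ℤ)) (hXT : X ⊆ T) :
    DeterminedBy (linked k X E₁ E₂) (Set.sym2 (slabLift k T)) := by
  rw [determinedBy_iff]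
  intro ω ω' h
  have hcong : ∀ x y, ω ∈ openConnIn (slabLift k X) x y ↔ ω' ∈ openConnIn (slabLift k X) x y := by
    intro x y
    refine openConnIn_congr (fun e he => ?_) x y
    have he' : e ∈ Set.sym2 (slabLift k T) := sym2_mono (slabLift_mono k hXT) he
    have := Set.ext_iff.1 h e
    simpa [Set.mem_inter_iff, he'] using this
  simp only [linked, Reach, Set.mem_setOf_eq, hcong]

/-- Rectangles are finite. [folklore] -/
private theorem boxR_finite' (a b c d : ℤ) : (boxR a b c d).Finite := by
  refine ((Set.finite_Icc a b).prod (Set.finite_Icc c d)).subset fun z hz => ?_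
  simp only [mem_boxR_iff] at hz
  exact ⟨⟨hz.1, hz.2.1⟩, ⟨hz.2.2.1, hz.2.2.2⟩⟩

/-- `linked` for a rectangle is a local event, hence measurable. [cite: NewmanTassionWu2017, Theorem 3.10 (proof)] -/
theorem measurableSet_linked_boxR (a b c d : ℤ) (E₁ E₂ : Set (ℤ × ℤ)) :
    MeasurableSet (linked k (boxR a b c d) E₁ E₂) := by
  refine measurableSet_of_isLocalEvent_holds ⟨(finite_sym2 (slabLift_finite k (boxR_finite' a b c d))).toFinset, ?_⟩
  rw [Set.Finite.coe_toFinset]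
  exact determinedBy_linked E₁ E₂ subset_rfl

/-! ## (3.66)–(3.74): the side crossings with unique hub clusters -/

section Uniq

variable {N n : ℕ}

/-- Intersections of local events are local. [folklore] -/
private theorem isLocalEvent_inter'' {A B : Set (BondConfig (slab 3 k))} (hA : IsLocalEvent A)
    (hB : IsLocalEvent B) : IsLocalEvent (A ∩ B) := by
  classical
  obtain ⟨F, hF⟩ := hA
  obtain ⟨G, hG⟩ := hB
  refine ⟨F ∪ G, ?_⟩
  rw [Finset.coe_union]
  exact (hF.mono Set.subset_union_left).inter (hG.mono Set.subset_union_right)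

/-- **One defect bound** (NTW (3.72)): for a side crossing `K`, the other three side crossings `Rest`
(increasing, local, determined by edges off the hub strip `boxR a b c d`) and the hub uniqueness event
`U = linked k (boxR a b c d) E₁ E₂`: if `P[hub crossed]² ≤ δ P[K]` (`δ ≥ 0`) then
`P[(K ∩ Rest) ∖ U] ≤ δ · P[K ∩ Rest]`. [cite: NewmanTassionWu2017, Theorem 3.10 (proof, (3.68)–(3.72))] -/
theorem real_defect_le (p : unitInterval) {a b c d : ℤ} {E₁ E₂ : Set (ℤ × ℤ)}
    {K Rest : Set (BondConfig (slab 3 k))} {T : Set (Sym2 (slab 3 k))}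
    (hKu : IsUpperSet K) (hKl : IsLocalEvent K) (hRu : IsUpperSet Rest) (hRl : IsLocalEvent Rest)
    (hRdet : DeterminedBy Rest T) (hT : Disjoint (Set.sym2 (slabLift k (boxR a b c d))) T) {δ : ℝ} (hδ0 : 0 ≤ δ)
    (hδ : (bondPercolation (slabGraph 3 k) p).real (slabConn k (boxR a b c d) E₁ E₂) ^ 2 ≤
      δ * (bondPercolation (slabGraph 3 k) p).real K) :
    (bondPercolation (slabGraph 3 k) p).real ((K ∩ Rest) ∩ (linked k (boxR a b c d) E₁ E₂)ᶜ) ≤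
      δ * (bondPercolation (slabGraph 3 k) p).real (K ∩ Rest) := by
  set P := bondPercolation (slabGraph 3 k) p
  have hRm : MeasurableSet Rest := measurableSet_of_isLocalEvent_holds hRl
  have h1 := real_inter_compl_linked_le (k := k) p (E₁ := E₁) (E₂ := E₂) (boxR_finite' a b c d) hRdet hRm hT
  have h2 : P.real K * P.real Rest ≤ P.real (K ∩ Rest) := harris_fkg_local (slabGraph 3 k) p hKu hRu hKl hRl
  calc P.real ((K ∩ Rest) ∩ (linked k (boxR a b c d) E₁ E₂)ᶜ)
      ≤ P.real (Rest ∩ (linked k (boxR a b c d) E₁ E₂)ᶜ) := measureReal_mono fun ω h => ⟨h.1.2, h.2⟩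
    _ ≤ P.real (slabConn k (boxR a b c d) E₁ E₂) ^ 2 * P.real Rest := h1
    _ ≤ δ * P.real K * P.real Rest := by gcongr
    _ = δ * (P.real K * P.real Rest) := by ring
    _ ≤ δ * P.real (K ∩ Rest) := mul_le_mul_of_nonneg_left h2 hδ0

/-- **`P[ℰ₀ ∩ 𝒰⁴] ≥ ½ Π P[sideCross]`** (NTW (3.66)–(3.74) in the port's geometry): if for each of the
four sides `P[hubCross_X]² ≤ δ · P[sideCross_X]` with `0 ≤ δ`, `4δ ≤ 1/2`, then the four side crossings
together with the uniqueness of the four hub clusters have probability at least half the product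
of the side-crossing probabilities. [cite: NewmanTassionWu2017, Theorem 3.10 (proof, (3.66)–(3.74))] -/
theorem real_sideCross_inter_hubUniq_ge (hN : 2 ≤ N) (p : unitInterval) {δ : ℝ} (hδ0 : 0 ≤ δ)
    (hδ : 4 * δ ≤ 1 / 2)
    (hT : (bondPercolation (slabGraph 3 k) p).real (hubCrossT k N n) ^ 2 ≤ δ * (bondPercolation (slabGraph 3 k) p).real (sideCrossT k N n))
    (hR : (bondPercolation (slabGraph 3 k) p).real (hubCrossR k N n) ^ 2 ≤ δ * (bondPercolation (slabGraph 3 k) p).real (sideCrossR k N n))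
    (hB : (bondPercolation (slabGraph 3 k) p).real (hubCrossB k N n) ^ 2 ≤ δ * (bondPercolation (slabGraph 3 k) p).real (sideCrossB k N n))
    (hL : (bondPercolation (slabGraph 3 k) p).real (hubCrossL k N n) ^ 2 ≤ δ * (bondPercolation (slabGraph 3 k) p).real (sideCrossL k N n)) :
    (1 / 2 : ℝ) * ((bondPercolation (slabGraph 3 k) p).real (sideCrossT k N n) *
        (bondPercolation (slabGraph 3 k) p).real (sideCrossR k N n) *
        (bondPercolation (slabGraph 3 k) p).real (sideCrossB k N n) *
        (bondPercolation (slabGraph 3 k) p).real (sideCrossL k N n)) ≤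
      (bondPercolation (slabGraph 3 k) p).real
        (sideCrossT k N n ∩ sideCrossR k N n ∩ sideCrossB k N n ∩ sideCrossL k N n ∩
          (hubUniqT k N n ∩ hubUniqR k N n ∩ hubUniqB k N n ∩ hubUniqL k N n)) := by
  set P := bondPercolation (slabGraph 3 k) p with hP
  set KT := sideCrossT k N n with hKT
  set KR := sideCrossR k N n with hKR
  set KB := sideCrossB k N n with hKB
  set KL := sideCrossL k N n with hKL
  set E₀ := KT ∩ KR ∩ KB ∩ KL with hE₀
  have upK : ∀ (B X Y : Set (ℤ × ℤ)), IsUpperSet (slabConn k B X Y) := fun B X Y => isUpperSet_openCrossing _ _ _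
  have locT : IsLocalEvent KT := isLocalEvent_slabConn_boxR _ _ _ _ _ _
  have locR : IsLocalEvent KR := isLocalEvent_slabConn_boxR _ _ _ _ _ _
  have locB : IsLocalEvent KB := isLocalEvent_slabConn_boxR _ _ _ _ _ _
  have locL : IsLocalEvent KL := isLocalEvent_slabConn_boxR _ _ _ _ _ _
  have upT : IsUpperSet KT := upK _ _ _
  have upR : IsUpperSet KR := upK _ _ _
  have upB : IsUpperSet KB := upK _ _ _
  have upL : IsUpperSet KL := upK _ _ _
  have fkg := fun {A B : Set (BondConfig (slab 3 k))} (hA : IsUpperSet A) (hB : IsUpperSet B)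
      (hAl : IsLocalEvent A) (hBl : IsLocalEvent B) => harris_fkg_local (slabGraph 3 k) p hA hB hAl hBl
  -- product bound by Harris–FKG
  have hprod : P.real KT * P.real KR * P.real KB * P.real KL ≤ P.real E₀ := by
    have h1 : P.real KT * P.real KR ≤ P.real (KT ∩ KR) := fkg upT upR locT locR
    have h2 : P.real (KT ∩ KR) * P.real KB ≤ P.real (KT ∩ KR ∩ KB) :=
      fkg (upT.inter upR) upB (isLocalEvent_inter'' locT locR) locB
    have h3 : P.real (KT ∩ KR ∩ KB) * P.real KL ≤ P.real E₀ :=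
      fkg ((upT.inter upR).inter upB) upL (isLocalEvent_inter'' (isLocalEvent_inter'' locT locR) locB) locL
    calc P.real KT * P.real KR * P.real KB * P.real KL ≤ P.real (KT ∩ KR) * P.real KB * P.real KL := by
          gcongr
      _ ≤ P.real (KT ∩ KR ∩ KB) * P.real KL := by gcongr
      _ ≤ P.real E₀ := h3
  -- determinacy of the "other three" by the edges of their sides
  have detOn : ∀ (B X Y T' : Set (ℤ × ℤ)), B ⊆ T' → DeterminedBy (slabConn k B X Y) (Set.sym2 (slabLift k T')) :=
    fun B X Y T' h => determinedBy_slabConn k X Y h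
  -- defect T: E₀ = KT ∩ (KR ∩ KB ∩ KL)
  have eT : E₀ = KT ∩ (KR ∩ KB ∩ KL) := by rw [hE₀]; ac_rfl
  have dT : P.real (E₀ ∩ (hubUniqT k N n)ᶜ) ≤ δ * P.real E₀ := by
    rw [eT]
    refine real_defect_le p upT locT ((upR.inter upB).inter upL)
      (isLocalEvent_inter'' (isLocalEvent_inter'' locR locB) locL)
      (T := Set.sym2 (slabLift k (ringSideR N n ∪ ringSideB N n ∪ ringSideL N n)))
      (((detOn _ _ _ _ (by intro z hz; simp only [Set.mem_union]; tauto)).inter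
        (detOn _ _ _ _ (by intro z hz; simp only [Set.mem_union]; tauto))).inter
        (detOn _ _ _ _ (by intro z hz; simp only [Set.mem_union]; tauto)))
      (disjoint_sym2_slabLift (Set.disjoint_left.2 fun z hz hz' => by
        simp only [ringSideR, ringSideB, ringSideL, Set.mem_union, mem_boxR_iff] at hz hz'; omega)) hδ0 hT
  -- defect R: E₀ = KR ∩ (KT ∩ KB ∩ KL)
  have eR : E₀ = KR ∩ (KT ∩ KB ∩ KL) := by rw [hE₀]; ac_rfl
  have dR : P.real (E₀ ∩ (hubUniqR k N n)ᶜ) ≤ δ * P.real E₀ := by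
    rw [eR]
    refine real_defect_le p upR locR ((upT.inter upB).inter upL)
      (isLocalEvent_inter'' (isLocalEvent_inter'' locT locB) locL)
      (T := Set.sym2 (slabLift k (ringSideT N n ∪ ringSideB N n ∪ ringSideL N n)))
      (((detOn _ _ _ _ (by intro z hz; simp only [Set.mem_union]; tauto)).inter
        (detOn _ _ _ _ (by intro z hz; simp only [Set.mem_union]; tauto))).inter
        (detOn _ _ _ _ (by intro z hz; simp only [Set.mem_union]; tauto)))
      (disjoint_sym2_slabLift (Set.disjoint_left.2 fun z hz hz' => by
        simp only [ringSideT, ringSideB, ringSideL, Set.mem_union, mem_boxR_iff] at hz hz'; omega)) hδ0 hR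
  -- defect B
  have eB : E₀ = KB ∩ (KT ∩ KR ∩ KL) := by rw [hE₀]; ac_rfl
  have dB : P.real (E₀ ∩ (hubUniqB k N n)ᶜ) ≤ δ * P.real E₀ := by
    rw [eB]
    refine real_defect_le p upB locB ((upT.inter upR).inter upL)
      (isLocalEvent_inter'' (isLocalEvent_inter'' locT locR) locL)
      (T := Set.sym2 (slabLift k (ringSideT N n ∪ ringSideR N n ∪ ringSideL N n)))
      (((detOn _ _ _ _ (by intro z hz; simp only [Set.mem_union]; tauto)).inter
        (detOn _ _ _ _ (by intro z hz; simp only [Set.mem_union]; tauto))).inter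
        (detOn _ _ _ _ (by intro z hz; simp only [Set.mem_union]; tauto)))
      (disjoint_sym2_slabLift (Set.disjoint_left.2 fun z hz hz' => by
        simp only [ringSideT, ringSideR, ringSideL, Set.mem_union, mem_boxR_iff] at hz hz'; omega)) hδ0 hB
  -- defect L
  have eL : E₀ = KL ∩ (KT ∩ KR ∩ KB) := by rw [hE₀]; ac_rfl
  have dL : P.real (E₀ ∩ (hubUniqL k N n)ᶜ) ≤ δ * P.real E₀ := by
    rw [eL]
    refine real_defect_le p upL locL ((upT.inter upR).inter upB)
      (isLocalEvent_inter'' (isLocalEvent_inter'' locT locR) locB)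
      (T := Set.sym2 (slabLift k (ringSideT N n ∪ ringSideR N n ∪ ringSideB N n)))
      (((detOn _ _ _ _ (by intro z hz; simp only [Set.mem_union]; tauto)).inter
        (detOn _ _ _ _ (by intro z hz; simp only [Set.mem_union]; tauto))).inter
        (detOn _ _ _ _ (by intro z hz; simp only [Set.mem_union]; tauto)))
      (disjoint_sym2_slabLift (Set.disjoint_left.2 fun z hz hz' => by
        simp only [ringSideT, ringSideR, ringSideB, Set.mem_union, mem_boxR_iff] at hz hz'; omega)) hδ0 hL
  -- union bound
  set U := hubUniqT k N n ∩ hubUniqR k N n ∩ hubUniqB k N n ∩ hubUniqL k N n with hU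
  have hcover : E₀ ⊆ (E₀ ∩ U) ∪ (E₀ ∩ (hubUniqT k N n)ᶜ) ∪ (E₀ ∩ (hubUniqR k N n)ᶜ) ∪
      (E₀ ∩ (hubUniqB k N n)ᶜ) ∪ (E₀ ∩ (hubUniqL k N n)ᶜ) := by
    intro ω hω
    by_cases h1 : ω ∈ hubUniqT k N n
    · by_cases h2 : ω ∈ hubUniqR k N n
      · by_cases h3 : ω ∈ hubUniqB k N n
        · by_cases h4 : ω ∈ hubUniqL k N n
          · exact Or.inl (Or.inl (Or.inl (Or.inl ⟨hω, ⟨⟨h1, h2⟩, h3⟩, h4⟩)))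
          · exact Or.inr ⟨hω, h4⟩
        · exact Or.inl (Or.inr ⟨hω, h3⟩)
      · exact Or.inl (Or.inl (Or.inr ⟨hω, h2⟩))
    · exact Or.inl (Or.inl (Or.inl (Or.inr ⟨hω, h1⟩)))
  have hsum : P.real E₀ ≤ P.real (E₀ ∩ U) + P.real (E₀ ∩ (hubUniqT k N n)ᶜ) + P.real (E₀ ∩ (hubUniqR k N n)ᶜ) +
      P.real (E₀ ∩ (hubUniqB k N n)ᶜ) + P.real (E₀ ∩ (hubUniqL k N n)ᶜ) := by
    refine (measureReal_mono hcover).trans ?_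
    refine (measureReal_union_le _ _).trans ?_
    gcongr
    refine (measureReal_union_le _ _).trans ?_
    gcongr
    refine (measureReal_union_le _ _).trans ?_
    gcongr
    exact measureReal_union_le _ _
  have key : (1 / 2 : ℝ) * P.real E₀ ≤ P.real (E₀ ∩ U) := by nlinarith [measureReal_nonneg (μ := P) (s := E₀)]
  calc (1 / 2 : ℝ) * (P.real KT * P.real KR * P.real KB * P.real KL) ≤ (1 / 2 : ℝ) * P.real E₀ := by
        gcongr
    _ ≤ P.real (E₀ ∩ U) := key

end Uniq

end NTW17

end Literature.Probability.Percolation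

end
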